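import Mathlib
import Summits.Ventures.HodgeRepro.Tier4.Target
import Summits.Ventures.HodgeRepro.Tier4.Line3.Defs
import Summits.Ventures.HodgeRepro.Tier4.Line3.DefsLemmas
import Summits.Ventures.HodgeRepro.Tier4.Line3.LocaliserS
import Summits.Ventures.HodgeRepro.Tier4.Line3.HasLocaliser
import Summits.Ventures.HodgeRepro.Tier4.Line3.HeckeEquivarianceLemmas
import Summits.Ventures.HodgeRepro.Tier4.Line3.TorusInvariance
import Summits.Ventures.HodgeRepro.Tier4.Line3.CoefMajorantWitness
import Summits.Ventures.HodgeRepro.Tier4.Line3.Witness.ThetaDataWitnessCf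

/-!
# Tier4/Line3/LocSScalarObstruction — the deep-level localiser interface `LocS` is EMPTY for scalar-symmetric data

Blind re-derivation cell `pub-hodge-repro`, Tier 4 «PROVE THE STEP» (README §9–§10), LINE L3 (orbit expansion of the quadruple
theta period, deep-level localisation at one split place), seat t4-L3-p2 (g2): the construction angle of the line's residual
«a localiser `ℓ : LocS D p L₀ xm` for the natural data» (plan-3 S13326; bus S13369).  The angle closes NEGATIVELY.

## The statement

`LocS D p L₀ xm` (Tier4/Line3/LocaliserS.lean, the FILED interface since v0.16) asks for Hecke combinations `loc N` with
`main_one : coefQ D.cf (loc N) xm = 1` and `supp`: every line tuple with a non-zero coefficient has a representative in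
`xm + (𝔭𝔭̄)^N L` for one of FINITELY MANY lattices `L ∋ xm` — support «up to the NORM-ONE torus `E′¹`».  `supp` and `main_one`
are jointly unsatisfiable as soon as the slot functions have ONE scalar symmetry up to the Gaussian of the definite places,
`ScalarSymmetric D u := ∀ j x, cf j (u • x) · gaussDef x = cf j x · gaussDef (u • x)`, for one `u ∈ E′` with `c(u) u ≠ 1`:
**`isEmpty_locS_of_scalarSymmetric`** (`xm 0 ≠ 0`).  Corollaries: `¬ HasLocaliser D`, and `¬ Nonempty (LocS D p L₀ xm)` under
the wedge clause — so `IsHeckeLocalisableP D`, `HasFactorisedLocaliser D` and every displayed hypothesis of the line's results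
`P_of_line_pos / _fac / _maj / _content / _gauss` are FALSE for such data.  The tree's witness of the `ThetaData` clauses, `cfW`
(Witness/ThetaDataWitnessCf p666772), is scalar-symmetric for EVERY unit of `𝓞_{E′}` (`scalarSymmetric_of_cf_eq_cfW`), and a
CM field with `[E′⁺ : ℚ] ≥ 2` has a unit with `c(u) u ≠ 1` (`exists_unit_norm_ne_one`, Dirichlet): `isEmpty_locS_of_cf_eq_cfW`
and `not_hasLocaliser_of_cf_eq_cfW` are the unconditional instances.

## The proof (four lines)
1. Every coset representative of a Hecke element is in `U(H)(E′)` (`isUnitaryOf_of_isFor`), commutes with the scalar `u`, and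
   preserves `gaussDef` (`gaussDef_mulVec_of_unitary`, p676981): every Hecke translate of every level inherits the symmetry
   (`heckeAct_smul_of_scalarSymmetric`), so `coefQ γ (u • x) · ∏ gaussDef (x_j) = coefQ γ x · ∏ gaussDef (u • x_j)`.
2. With `main_one`, `coefQ (loc N) (u • xm) ≠ 0` at EVERY depth; torus invariance (`coefQ_smul`, `exists_torus_of_lines_eq`,
   `lines_rep`) moves this to the chosen representative of the line tuple of `u • xm`.
3. `supp` gives `x` with `lines x = lines (u • xm)` and `x j − xm j ∈ (𝔭𝔭̄)^N L`, `L ∈ S`: `(t₀ u − 1) · xm 0 i ∈ (𝔭𝔭̄)^N · π_i(L)`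
   for a norm-one `t₀` and a coordinate `i` with `xm 0 i ≠ 0`.
4. A common denominator `d` of the finitely many `π_i(L)` and of `m = xm 0 i` gives `q_N := (t₀ u − 1) m′ ∈ (𝔭𝔭̄)^N`,
   `m′ = d m ≠ 0`; with `c(𝔭𝔭̄) = 𝔭𝔭̄` and `t₀ c(t₀) = 1`, `z_N := q_N c(q_N) + q_N c(m′) + c(q_N) m′ ∈ (𝔭𝔭̄)^N` equals
   `m′ c(m′) (c(u) u − 1)` for every `N` (`key_identity`); Krull (`Ideal.iInf_pow_eq_bot_of_isDomain`) forces `c(u) u = 1`.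

## What it means for the line
The obstruction is the algebra of the tree's own model: the Hecke action is GEOMETRIC on coefficient functions on `V(E′)`
(`heckeAct`), scalars commute with it, and the only torus the interface allows is `E′¹`.  On paper the GENUINE coefficient
system `cf_j = ∏_v ∫_{E′¹_v} μχ(t) φ_v(t⁻¹ x_v) dt` is scalar-symmetric for every unit `u ≡ 1` modulo the conductor of the bad
places (lattice indicators at good places are `𝓞_v^×`-invariant; the definite places give exactly the `gaussDef` ratio), so NO
genuine localiser satisfies `LocS.supp` either; the honest clause is «support up to ALL scalars», under which the orbits of
`ε⁻¹ · xm`, `ε ∈ 𝓞_{E′⁺}^×`, keep a non-zero coefficient at every depth and L3.4 «foreign orbits die» fails for them (the main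
term must be re-summed over the scaled copies; the signs agree, so the positivity mechanism survives, the `Localizer` assembly
as typed does not).  The irreducible `Ind_{P_{1,2}}^{GL_3}(μ ⊗ 1)` of strategy step 3 lives in the 3-variable Schrödinger
model, where the scalars ARE the torus — not in the 6-variable model the tree sums over.  Record: proofs/t4/L3/LOCS-SCALAR-OBSTRUCTION.md.
Nothing here says anything about the status of the Hodge conjecture for CM abelian varieties, which is NOT proved
(HC_CM is NOT proved by anyone in this repository).
-/

set_option autoImplicit false

noncomputable section

namespace Summit.Ventures.HodgeRepro.Tier4.Line3

open Summit.Ventures.HodgeRepro.Tier4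
open Matrix NumberField
open scoped ComplexConjugate

/-! ### 1. Commutative algebra: Krull, denominators, the key identity -/

/-- An element of a Noetherian domain lying in every power of a proper ideal is zero (Krull's intersection theorem). -/
theorem eq_zero_of_forall_mem_pow {R : Type*} [CommRing R] [IsDomain R] [IsNoetherianRing R] {I : Ideal R}
    (hI : I ≠ ⊤) {z : R} (hz : ∀ N : ℕ, z ∈ I ^ N) : z = 0 := by
  have h : z ∈ (⨅ i : ℕ, I ^ i) := Ideal.mem_iInf.2 hz
  rwa [Ideal.iInf_pow_eq_bot_of_isDomain I hI, Ideal.mem_bot] at h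

/-- Clearing a common denominator `d` of `𝔞` inside `I • 𝔞`: `d • y` is the image of an element of `I`. -/
theorem exists_mem_of_mem_smul {R P : Type*} [CommRing R] [CommRing P] [Algebra R P] (I : Ideal R)
    (𝔞 : Submodule R P) (d : R) (hd : ∀ b ∈ 𝔞, ∃ b' : R, algebraMap R P b' = d • b) {y : P}
    (hy : y ∈ I • 𝔞) : ∃ q ∈ I, algebraMap R P q = d • y := by
  refine Submodule.smul_induction_on hy ?_ ?_
  · intro r hr b hb
    obtain ⟨b', hb'⟩ := hd b hb
    refine ⟨r * b', I.mul_mem_right b' hr, ?_⟩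
    rw [map_mul, smul_comm, ← hb', Algebra.smul_def]
  · rintro x y ⟨q₁, hq₁, hx⟩ ⟨q₂, hq₂, hy⟩
    exact ⟨q₁ + q₂, I.add_mem hq₁ hq₂, by rw [map_add, hx, hy, smul_add]⟩

/-- The identity behind the obstruction: with `Q = (T u − 1) M` and `c(T) T = 1`,
`Q c(Q) + Q c(M) + c(Q) M = M c(M) (c(u) u − 1)`. -/
theorem key_identity {E : Type*} [Field E] (c : E ≃+* E) (u T M Q : E) (hT : c T * T = 1)
    (hQ : Q = (T * u - 1) * M) : Q * c Q + Q * c M + c Q * M = M * c M * (c u * u - 1) := by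
  subst hQ
  simp only [map_mul, map_sub, map_one]
  linear_combination (M * c M * u * c u) * hT

/-- Transport of a quadruple product along four slot identities (the real Gaussians pass through `conj`). -/
theorem quad_transport {a A0 A1 A2 A3 B0 B1 B2 B3 : ℂ} {g0 g1 g2 g3 k0 k1 k2 k3 : ℝ}
    (h0 : B0 * g0 = A0 * k0) (h1 : B1 * g1 = A1 * k1) (h2 : B2 * g2 = A2 * k2) (h3 : B3 * g3 = A3 * k3) :
    a * (B0 * B1) * conj (B2 * B3) * ((g0 : ℂ) * g1 * g2 * g3) =
      a * (A0 * A1) * conj (A2 * A3) * ((k0 : ℂ) * k1 * k2 * k3) := by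
  have h2c : conj B2 * (g2 : ℂ) = conj A2 * (k2 : ℂ) := by
    simpa only [map_mul, Complex.conj_ofReal] using congrArg conj h2
  have h3c : conj B3 * (g3 : ℂ) = conj A3 * (k3 : ℂ) := by
    simpa only [map_mul, Complex.conj_ofReal] using congrArg conj h3
  calc a * (B0 * B1) * conj (B2 * B3) * ((g0 : ℂ) * g1 * g2 * g3)
      = a * (B0 * g0) * (B1 * g1) * (conj B2 * g2) * (conj B3 * g3) := by rw [map_mul]; ring
    _ = a * (A0 * k0) * (A1 * k1) * (conj A2 * k2) * (conj A3 * k3) := by rw [h0, h1, h2c, h3c]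
    _ = a * (A0 * A1) * conj (A2 * A3) * ((k0 : ℂ) * k1 * k2 * k3) := by rw [map_mul]; ring

namespace T4Data

variable (X : T4Data)

/-! ### 2. Denominators and the conjugation on ideals, over the objects of the line -/

/-- A finitely generated `𝓞`-submodule of `E′` has a common denominator. -/
theorem exists_denominator_of_fg {𝔞 : Submodule (RingOfIntegers X.E) X.E} (h : 𝔞.FG) :
    ∃ d : RingOfIntegers X.E, d ≠ 0 ∧ ∀ b ∈ 𝔞, ∃ b' : RingOfIntegers X.E, algebraMap _ X.E b' = d • b := by
  obtain ⟨d, hd, hint⟩ := FractionalIdeal.isFractional_of_fg (S := nonZeroDivisors (RingOfIntegers X.E)) h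
  refine ⟨d, nonZeroDivisors.ne_zero hd, fun b hb => ?_⟩
  obtain ⟨b', hb'⟩ := RingHom.mem_rangeS.1 (hint b hb)
  exact ⟨b', hb'⟩

/-- A common denominator for the `i`-th coordinate projections of finitely many finitely generated lattices and for one
element `m` of `E′`. -/
theorem exists_common_denominator (S : Finset (Submodule (RingOfIntegers X.E) (Fin 3 → X.E)))
    (hS : ∀ L ∈ S, L.FG) (i : Fin 3) (m : X.E) :
    ∃ d : RingOfIntegers X.E, d ≠ 0 ∧
      (∀ L ∈ S, ∀ b ∈ L.map (LinearMap.proj i : (Fin 3 → X.E) →ₗ[RingOfIntegers X.E] X.E),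
        ∃ b' : RingOfIntegers X.E, algebraMap _ X.E b' = d • b) ∧
      ∃ m' : RingOfIntegers X.E, algebraMap _ X.E m' = d • m := by
  have hden : ∀ L ∈ S, ∃ d : RingOfIntegers X.E, d ≠ 0 ∧
      ∀ b ∈ L.map (LinearMap.proj i : (Fin 3 → X.E) →ₗ[RingOfIntegers X.E] X.E),
        ∃ b' : RingOfIntegers X.E, algebraMap _ X.E b' = d • b :=
    fun L hL => X.exists_denominator_of_fg ((hS L hL).map _)
  choose! dL hdL using hden
  obtain ⟨⟨n, dm⟩, hdm⟩ := IsLocalization.surj (nonZeroDivisors (RingOfIntegers X.E)) m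
  refine ⟨(∏ L ∈ S, dL L) * dm.1,
    mul_ne_zero (Finset.prod_ne_zero_iff.2 fun L hL => (hdL L hL).1) (nonZeroDivisors.ne_zero dm.2), ?_, ?_⟩
  · intro L hL b hb
    obtain ⟨b', hb'⟩ := (hdL L hL).2 b hb
    refine ⟨(∏ L' ∈ S.erase L, dL L') * dm.1 * b', ?_⟩
    rw [Algebra.smul_def] at hb' ⊢
    rw [← Finset.prod_erase_mul S dL hL]
    simp only [map_mul]
    rw [hb']
    ring
  · refine ⟨(∏ L ∈ S, dL L) * n, ?_⟩
    rw [Algebra.smul_def, map_mul, map_mul, ← hdm]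
    ring

/-- The conjugation `c′` restricted to `𝓞_{E′}`, as the ring homomorphism the tree's `conjIdeal` uses. -/
abbrev conjO : RingOfIntegers X.E →+* RingOfIntegers X.E := (RingOfIntegers.mapRingEquiv X.c).toRingHom

/-- `conjO` is `c′` on the underlying elements. -/
theorem coe_conjO (r : RingOfIntegers X.E) : (algebraMap _ X.E (X.conjO r)) = X.c (algebraMap _ X.E r) := rfl

/-- `c′` is an involution. -/
theorem c_apply_c (t : X.E) : X.c (X.c t) = t := IsCMField.complexConj_apply_apply X.E t

/-- `conjO` is an involution. -/
theorem conjO_comp_conjO : X.conjO.comp X.conjO = RingHom.id _ := by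
  ext r
  rw [RingHom.comp_apply, RingHom.id_apply, RingOfIntegers.coe_eq_algebraMap, RingOfIntegers.coe_eq_algebraMap,
    X.coe_conjO, X.coe_conjO, X.c_apply_c]

/-- The depth ideal `𝔭𝔭̄` is stable under `c′`. -/
theorem map_conjO_mul_conjIdeal (I : Ideal (RingOfIntegers X.E)) :
    Ideal.map X.conjO (I * X.conjIdeal I) = I * X.conjIdeal I := by
  unfold T4Data.conjIdeal
  rw [Ideal.map_mul, Ideal.map_map, X.conjO_comp_conjO, Ideal.map_id, mul_comm]

/-- `𝔭𝔭̄` is a proper ideal. -/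
theorem mul_conjIdeal_ne_top (p : IsDedekindDomain.HeightOneSpectrum (RingOfIntegers X.E)) :
    p.asIdeal * X.conjIdeal p.asIdeal ≠ ⊤ := by
  intro h
  have hle : p.asIdeal * X.conjIdeal p.asIdeal ≤ p.asIdeal := Ideal.mul_le_right
  rw [h] at hle
  exact p.isPrime.ne_top (top_le_iff.1 hle)

/-! ### 3. Scalar symmetry and its inheritance by all Hecke translates -/

/-- **A SCALAR SYMMETRY of the slot functions up to the Gaussian of the definite places**: `cf j (u • x) / gaussDef (u • x)`
is independent of the scalar `u` — `cf j (u • x) · gaussDef x = cf j x · gaussDef (u • x)`.  True of the tree's witness `cfW`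
for every unit `u` (`scalarSymmetric_of_cf_eq_cfW`); on paper, true of the genuine coefficient system for every unit `u ≡ 1`
modulo the conductor of the bad places (module docstring). -/
def ScalarSymmetric (D : X.ThetaData) (u : X.E) : Prop :=
  ∀ (j : Fin 4) (x : Fin 3 → X.E), D.cf j (u • x) * (X.gaussDef x : ℂ) = D.cf j x * (X.gaussDef (u • x) : ℂ)

/-- Every Hecke translate of every level inherits the scalar symmetry: the representatives are unitary, commute with the
scalar and preserve `gaussDef`. -/
theorem heckeAct_smul_of_scalarSymmetric (D : X.ThetaData) {u : X.E} (hu : X.ScalarSymmetric D u)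
    (K : X.Level) {h : HeckeElement X.E} (hh : h.IsFor X.c X.H K.1) (j : Fin 4) (x : Fin 3 → X.E) :
    X.heckeAct h (D.cf j) (u • x) * (X.gaussDef x : ℂ) = X.heckeAct h (D.cf j) x * (X.gaussDef (u • x) : ℂ) := by
  unfold T4Data.heckeAct
  rw [← List.sum_map_mul_right, ← List.sum_map_mul_right]
  congr 1
  refine List.map_congr_left fun t ht => ?_
  rw [smul_mul_assoc, smul_mul_assoc, Finset.sum_mul, Finset.sum_mul]
  congr 1
  refine Finset.sum_congr rfl fun r hr => ?_
  have hru : IsUnitaryOf X.c X.H r := HeckeEquivariance.isUnitaryOf_of_isFor X K hh ht hr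
  rw [Matrix.mulVec_smul, ← X.gaussDef_mulVec_of_unitary hru x, hu j, ← Matrix.mulVec_smul,
    X.gaussDef_mulVec_of_unitary hru]

/-- The quadruple coefficient of every Hecke combination inherits the scalar symmetry slot by slot. -/
theorem coefQ_smul_of_scalarSymmetric (D : X.ThetaData) {u : X.E} (hu : X.ScalarSymmetric D u)
    {K : X.Level} (γ : X.Tr K) (x : X.Tuple) :
    X.coefQ D.cf γ (fun j => u • x j) * ∏ j, (X.gaussDef (x j) : ℂ) =
      X.coefQ D.cf γ x * ∏ j, (X.gaussDef (u • x j) : ℂ) := by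
  unfold T4Data.coefQ
  rw [Finsupp.sum_mul, Finsupp.sum_mul]
  refine Finsupp.sum_congr fun h _ => ?_
  simp only [Fin.prod_univ_four]
  exact quad_transport (X.heckeAct_smul_of_scalarSymmetric D hu K (h.2 (X.slot 0)) 0 (x 0))
    (X.heckeAct_smul_of_scalarSymmetric D hu K (h.2 (X.slot 1)) 1 (x 1))
    (X.heckeAct_smul_of_scalarSymmetric D hu K (h.2 (X.slot 2)) 2 (x 2))
    (X.heckeAct_smul_of_scalarSymmetric D hu K (h.2 (X.slot 3)) 3 (x 3))

/-! ### 4. The obstruction -/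

/-- **THE INTERFACE `LocS` IS EMPTY FOR SCALAR-SYMMETRIC DATA.**  If the slot functions of `D` have a scalar symmetry for one
`u` with `c(u) u ≠ 1` and `xm 0 ≠ 0`, there is no deep-level localiser around `xm` at any prime `𝔭`, for any `L₀`: the clauses
`supp` (support up to the norm-one torus) and `main_one` contradict each other at large depth. -/
theorem isEmpty_locS_of_scalarSymmetric (D : X.ThetaData) {u : X.E} (hu : X.ScalarSymmetric D u)
    (hN : X.c u * u ≠ 1) (p : IsDedekindDomain.HeightOneSpectrum (RingOfIntegers X.E))
    (L₀ : Submodule (RingOfIntegers X.E) (Fin 3 → X.E)) (xm : X.Tuple) (hxm : xm 0 ≠ 0) :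
    IsEmpty (X.LocS D p L₀ xm) := by
  refine ⟨fun ℓ => ?_⟩
  obtain ⟨S, hS, hsupp⟩ := ℓ.supp
  obtain ⟨i, hi⟩ : ∃ i, xm 0 i ≠ 0 := by
    by_contra hcon
    exact hxm (funext fun i => not_not.1 (not_exists.1 hcon i))
  obtain ⟨d, hd0, hdS, m', hm'⟩ := X.exists_common_denominator S (fun L hL => (hS L hL).1.1) i (xm 0 i)
  have hm'0 : algebraMap _ X.E m' ≠ 0 := by
    rw [hm', Algebra.smul_def]
    exact mul_ne_zero ((IsFractionRing.injective (RingOfIntegers X.E) X.E).ne_iff' (map_zero _) |>.2 hd0) hi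
  set 𝔮 : Ideal (RingOfIntegers X.E) := p.asIdeal * X.conjIdeal p.asIdeal with h𝔮
  have h𝔮top : 𝔮 ≠ ⊤ := X.mul_conjIdeal_ne_top p
  have hσ𝔮 : Ideal.map X.conjO 𝔮 = 𝔮 := X.map_conjO_mul_conjIdeal p.asIdeal
  -- Step 2–3: at every depth, a norm-one `T` and `q ∈ 𝔮^N` with `q = (T u − 1) m′`.
  have hstep : ∀ N : ℕ, ∃ (T : X.E) (q : RingOfIntegers X.E), X.c T * T = 1 ∧ q ∈ 𝔮 ^ N ∧
      algebraMap _ X.E q = (T * u - 1) * algebraMap _ X.E m' := by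
    intro N
    have hne : X.coefQ D.cf (ℓ.loc N) (X.rep (X.lines fun j => u • xm j)) ≠ 0 := by
      intro h0
      obtain ⟨t, ht, hrep⟩ := X.exists_torus_of_lines_eq (X.lines_rep (X.lines fun j => u • xm j))
      have h1 : X.coefQ D.cf (ℓ.loc N) (fun j => u • xm j) = 0 := by
        have heq : (fun j => u • xm j) = fun j => t j • X.rep (X.lines fun j => u • xm j) j :=
          funext fun j => hrep j
        rw [heq, X.coefQ_smul D.cf D.weight (ℓ.loc N) t ht, h0]
      have h2 := X.coefQ_smul_of_scalarSymmetric D hu (ℓ.loc N) xm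
      rw [h1, ℓ.main_one N, zero_mul, one_mul] at h2
      refine (Finset.prod_ne_zero_iff.2 fun j _ => ?_) h2.symm
      exact Complex.ofReal_ne_zero.2 (X.gaussDef_pos (u • xm j)).ne'
    obtain ⟨x, hx, L, hL, hxL⟩ := hsupp N _ hne
    obtain ⟨t, ht, hxt⟩ := X.exists_torus_of_lines_eq hx.symm
    have hx0 : x 0 = t 0 • (u • xm 0) := hxt 0
    have h0 : (t 0 * u - 1) • xm 0 ∈ 𝔮 ^ N • L := by
      have e : x 0 - xm 0 = (t 0 * u - 1) • xm 0 := by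
        rw [hx0, smul_smul, sub_smul, one_smul]
      have := hxL 0
      rwa [e] at this
    have h1 : (t 0 * u - 1) * xm 0 i ∈
        𝔮 ^ N • L.map (LinearMap.proj i : (Fin 3 → X.E) →ₗ[RingOfIntegers X.E] X.E) := by
      have := Submodule.mem_map_of_mem
        (f := (LinearMap.proj i : (Fin 3 → X.E) →ₗ[RingOfIntegers X.E] X.E)) h0
      rw [Submodule.map_smul''] at this
      simpa only [LinearMap.proj_apply, Pi.smul_apply, smul_eq_mul] using this
    obtain ⟨q, hq, hq'⟩ := exists_mem_of_mem_smul (𝔮 ^ N) _ d (hdS L hL) h1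
    refine ⟨t 0, q, ht 0, hq, ?_⟩
    rw [hq', hm', Algebra.smul_def, Algebra.smul_def]
    ring
  choose T q hT hq hq' using hstep
  -- Step 4: the elements `z_N` all equal `m′ c(m′) (c(u) u − 1)` and lie in `𝔮^N`.
  have hzval : ∀ N, algebraMap _ X.E (q N * X.conjO (q N) + q N * X.conjO m' + X.conjO (q N) * m') =
      algebraMap _ X.E (m' * X.conjO m') * (X.c u * u - 1) := by
    intro N
    simp only [map_add, map_mul, X.coe_conjO]
    exact key_identity X.c u (T N) _ _ (hT N) (hq' N)
  have hzmem : ∀ N, q N * X.conjO (q N) + q N * X.conjO m' + X.conjO (q N) * m' ∈ 𝔮 ^ N := by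
    intro N
    have hσq : X.conjO (q N) ∈ 𝔮 ^ N := by
      have := Ideal.mem_map_of_mem X.conjO (hq N)
      rwa [Ideal.map_pow, hσ𝔮] at this
    exact (𝔮 ^ N).add_mem ((𝔮 ^ N).add_mem ((𝔮 ^ N).mul_mem_right _ (hq N)) ((𝔮 ^ N).mul_mem_right _ (hq N)))
      ((𝔮 ^ N).mul_mem_right _ hσq)
  have hzeq : ∀ N, q N * X.conjO (q N) + q N * X.conjO m' + X.conjO (q N) * m' =
      q 0 * X.conjO (q 0) + q 0 * X.conjO m' + X.conjO (q 0) * m' := fun N =>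
    RingOfIntegers.ext ((hzval N).trans (hzval 0).symm)
  have hz0 : q 0 * X.conjO (q 0) + q 0 * X.conjO m' + X.conjO (q 0) * m' = 0 :=
    eq_zero_of_forall_mem_pow h𝔮top fun N => hzeq N ▸ hzmem N
  have hfinal := hzval 0
  rw [hz0, map_zero] at hfinal
  have hne' : algebraMap _ X.E (m' * X.conjO m') ≠ 0 := by
    rw [map_mul, X.coe_conjO]
    exact mul_ne_zero hm'0 ((map_ne_zero_iff X.c X.c.injective).2 hm'0)
  exact hN (sub_eq_zero.1 ((mul_eq_zero.1 hfinal.symm).resolve_left hne'))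

/-! ### 5. Corollaries: every displayed hypothesis of the line is false for scalar-symmetric data -/

/-- The wedge clause of the line's tuples forces `xm 0 ≠ 0` (the ball coordinates of `0` vanish). -/
theorem ne_zero_of_wedge {xm : X.Tuple}
    (hab : X.ballCoord (xm 0) 0 * X.ballCoord (xm 1) 1 - X.ballCoord (xm 0) 1 * X.ballCoord (xm 1) 0 ≠ 0) :
    xm 0 ≠ 0 := fun h0 => hab (by
  have hz : X.ballCoord 0 = 0 := by
    unfold T4Data.ballCoord
    rw [show (fun i => X.τ₀ ((0 : Fin 3 → X.E) i)) = (0 : Fin 3 → ℂ) from funext fun i => by simp, Matrix.mulVec_zero]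
  rw [h0, hz]; simp)

/-- No printed localiser (`HasLocaliser`, Tier4/Line3/HasLocaliser.lean) for scalar-symmetric data. -/
theorem not_hasLocaliser_of_scalarSymmetric (D : X.ThetaData) {u : X.E} (hu : X.ScalarSymmetric D u)
    (hN : X.c u * u ≠ 1) : ¬ X.HasLocaliser D := by
  rintro ⟨p, L₀, xm, -, -, -, -, hab, -, ⟨ℓ⟩⟩
  exact (X.isEmpty_locS_of_scalarSymmetric D hu hN p L₀ xm (X.ne_zero_of_wedge hab)).false ℓ

/-- Under the wedge clause of the line's tuples no `LocS` exists — hence no `LocSI`, `LocPS`, `LocES` (they extend `LocS`). -/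
theorem not_exists_locS_of_scalarSymmetric (D : X.ThetaData) {u : X.E} (hu : X.ScalarSymmetric D u)
    (hN : X.c u * u ≠ 1) (p : IsDedekindDomain.HeightOneSpectrum (RingOfIntegers X.E))
    (L₀ : Submodule (RingOfIntegers X.E) (Fin 3 → X.E)) (xm : X.Tuple)
    (hab : X.ballCoord (xm 0) 0 * X.ballCoord (xm 1) 1 - X.ballCoord (xm 0) 1 * X.ballCoord (xm 1) 0 ≠ 0) :
    ¬ Nonempty (X.LocS D p L₀ xm) := by
  rintro ⟨ℓ⟩
  exact (X.isEmpty_locS_of_scalarSymmetric D hu hN p L₀ xm (X.ne_zero_of_wedge hab)).false ℓ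

/-! ### 6. The tree's witness `cfW` is scalar-symmetric for every unit, and a unit with `c(u) u ≠ 1` exists -/

/-- Membership in the standard lattice is invariant under multiplication by a unit of `𝓞_{E′}`. -/
theorem unit_smul_mem_Lstd_iff (u : (RingOfIntegers X.E)ˣ) (v : Fin 3 → X.E) :
    (algebraMap _ X.E (u : RingOfIntegers X.E)) • v ∈ X.Lstd ↔ v ∈ X.Lstd := by
  rw [X.mem_Lstd_iff, X.mem_Lstd_iff]
  constructor
  · intro h i
    have hinv : (algebraMap _ X.E ((u⁻¹ : (RingOfIntegers X.E)ˣ) : RingOfIntegers X.E)) *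
        (algebraMap _ X.E (u : RingOfIntegers X.E)) = 1 := by
      rw [← map_mul, Units.inv_mul, map_one]
    have := ((u⁻¹ : (RingOfIntegers X.E)ˣ) : RingOfIntegers X.E).isIntegral_coe.mul (h i)
    rwa [Pi.smul_apply, smul_eq_mul, ← mul_assoc, hinv, one_mul] at this
  · exact fun h i => by rw [Pi.smul_apply, smul_eq_mul]; exact (u : RingOfIntegers X.E).isIntegral_coe.mul (h i)

/-- **The witness `cfW` is scalar-symmetric for every unit of `𝓞_{E′}`.** -/
theorem scalarSymmetric_of_cf_eq_cfW (D : X.ThetaData) (hD : D.cf = X.cfW) (u : (RingOfIntegers X.E)ˣ) :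
    X.ScalarSymmetric D (algebraMap _ X.E (u : RingOfIntegers X.E)) := by
  intro j x
  rw [hD]
  unfold T4Data.cfW
  have hcond : (∃ t : X.E, X.c t * t = 1 ∧ t • ((algebraMap _ X.E (u : RingOfIntegers X.E)) • x) ∈ X.Lstd) ↔
      ∃ t : X.E, X.c t * t = 1 ∧ t • x ∈ X.Lstd := by
    refine exists_congr fun t => and_congr_right fun _ => ?_
    rw [smul_comm, X.unit_smul_mem_Lstd_iff]
  by_cases hc : ∃ t : X.E, X.c t * t = 1 ∧ t • x ∈ X.Lstd
  · rw [if_pos (hcond.2 hc), if_pos hc, mul_comm]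
  · rw [if_neg (fun h => hc (hcond.1 h)), if_neg hc, zero_mul, zero_mul]

/-- A CM field with `[E′⁺ : ℚ] ≥ 2` has at least two infinite places. -/
theorem two_le_card_infinitePlace : 2 ≤ Fintype.card (InfinitePlace X.E) := by
  rw [← IsCMField.card_infinitePlace_eq_card_infinitePlace X.E,
    InfinitePlace.card_eq_nrRealPlaces_add_nrComplexPlaces, IsTotallyReal.nrComplexPlaces_eq_zero, add_zero,
    ← IsTotallyReal.finrank]
  exact X.hE

/-- **A unit with `c(u) u ≠ 1` exists** (Dirichlet: a unit `< 1` at every place but one; a norm-one element has `w(u) = 1`). -/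
theorem exists_unit_norm_ne_one :
    ∃ u : (RingOfIntegers X.E)ˣ, X.c (algebraMap _ X.E (u : RingOfIntegers X.E)) *
      algebraMap _ X.E (u : RingOfIntegers X.E) ≠ 1 := by
  obtain ⟨w₁, w₂, hne⟩ := Fintype.exists_pair_of_one_lt_card (lt_of_lt_of_le one_lt_two X.two_le_card_infinitePlace)
  obtain ⟨u, hu⟩ := Units.dirichletUnitTheorem.exists_unit X.E w₁
  refine ⟨u, fun h => ?_⟩
  have h2 := hu w₂ hne.symm
  have hsq : w₂ (algebraMap _ X.E (u : RingOfIntegers X.E)) * w₂ (algebraMap _ X.E (u : RingOfIntegers X.E)) = 1 := by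
    simpa only [map_mul, map_one, show X.c (algebraMap _ X.E (u : RingOfIntegers X.E)) =
      IsCMField.complexConj X.E (algebraMap _ X.E (u : RingOfIntegers X.E)) from rfl,
      IsCMField.infinitePlace_complexConj] using congrArg w₂ h
  have hw : w₂ (algebraMap _ X.E (u : RingOfIntegers X.E)) = 1 := by
    nlinarith [apply_nonneg w₂ (algebraMap _ X.E (u : RingOfIntegers X.E))]
  rw [hw, Real.log_one] at h2
  exact lt_irrefl _ h2

/-- **THE UNCONDITIONAL INSTANCE**: for every datum whose slot functions are the tree's witness `cfW`, `LocS` is empty around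
every `xm` with `xm 0 ≠ 0`, at every prime, for every `L₀`. -/
theorem isEmpty_locS_of_cf_eq_cfW (D : X.ThetaData) (hD : D.cf = X.cfW)
    (p : IsDedekindDomain.HeightOneSpectrum (RingOfIntegers X.E))
    (L₀ : Submodule (RingOfIntegers X.E) (Fin 3 → X.E)) (xm : X.Tuple) (hxm : xm 0 ≠ 0) :
    IsEmpty (X.LocS D p L₀ xm) := by
  obtain ⟨u, hu⟩ := X.exists_unit_norm_ne_one
  exact X.isEmpty_locS_of_scalarSymmetric D (X.scalarSymmetric_of_cf_eq_cfW D hD u) hu p L₀ xm hxm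

/-- No printed localiser for a datum with the witness slot functions. -/
theorem not_hasLocaliser_of_cf_eq_cfW (D : X.ThetaData) (hD : D.cf = X.cfW) : ¬ X.HasLocaliser D := by
  obtain ⟨u, hu⟩ := X.exists_unit_norm_ne_one
  exact X.not_hasLocaliser_of_scalarSymmetric D (X.scalarSymmetric_of_cf_eq_cfW D hD u) hu

end T4Data

end Summit.Ventures.HodgeRepro.Tier4.Line3

end
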